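import Summits.ResolutionOfSingularities.ResolutionOfSingularities.Theorems.PurelyInseparableDim4ChartZigzagStep
import HarnessLib

/-!
# Purely inseparable four-folds: SET ALGEBRA through the zigzag comparison `ε` (brick S3 (c) v4, tranche 1, brick A1g; cell `res-dim4-pi`)

[OURS · counted 0] (D-0157 DOOR 2; host item stmt-ResolutionOfSingularities-16155, helper). Nothing here proves resolution of
singularities in dimension ≥ 4 / characteristic `p`. For the zigzag comparison `ε : π⁻¹ φ(Y) ≅ B⁻¹ ψ(Y)` of v3/v4 (any blow-ups `π` of the
stage and `B` of the model), the image in `W` of a model piece `T ⊆ X₀` through `(φ₀|) ≫ ε⁻¹ ≫ ι` IS the PULL `ι_W(ε⁻¹(ι_Bl⁻¹(φ₀ T)))` of the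
model image `φ₀(T) ⊆ Bl`; the pull is the image under an injection of a preimage, so it preserves inclusions, unions and disjointness —
the bookkeeping by which A1 (memo §10 steps (4), (6)) moves typ-2's cover and A1a's ownership partition from `Bl` to the stage.

* **`zigzag_transport_image_eq_pull`**, `zigzag_pull_mono`, `zigzag_pull_union`, `zigzag_pull_iUnion₂`, `zigzag_pull_inter`,
  **`zigzag_pull_disjoint`**, `zigzag_pull_subset_preimage_opensRange`.

AI-produced formalisation, weaker than expert review. bears_on: LADDER-RESOLUTION:D157-DOOR2 (res-dim4-pi · S3 (c) v4 A1g).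
-/

set_option linter.dupNamespace false -- D-0017: single-problem summit path `Summit.<S>.<S>.…` by design

noncomputable section

open CategoryTheory AlgebraicGeometry Opposite TopologicalSpace

namespace Summit.ResolutionOfSingularities.ResolutionOfSingularities.Theorems.PIDim4

open Literature.AlgebraicGeometry.Resolution
open Literature.AlgebraicGeometry.Resolution.AffinePointBlowup (P A γ coord Wtop ξ)

namespace Equimultiple

section ZigzagSets

variable {K : Type} [Field K] {Z Y W Bl X₀ : Scheme.{0}} (φ : Y ⟶ Z) [IsOpenImmersion φ] (ψ : Y ⟶ P 4 K) [IsOpenImmersion ψ]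
  {π : W ⟶ Z} {B : Bl ⟶ P 4 K}
  (ε : (π ⁻¹ᵁ φ.opensRange : Scheme.{0}) ≅ (B ⁻¹ᵁ ψ.opensRange : Scheme.{0})) (φ₀ : X₀ ⟶ Bl)

/-- **The transported image is the pull of the model image**:
`((φ₀|) ≫ ε⁻¹ ≫ ι)(ι⁻¹ T) = ι_W (ε.hom⁻¹ (ι_Bl⁻¹ (φ₀ T)))`. [cite: StacksProject, Tag 01J7] -/
theorem zigzag_transport_image_eq_pull (T : Set X₀) :
    ((φ₀ ∣_ (B ⁻¹ᵁ ψ.opensRange)) ≫ ε.inv ≫ (π ⁻¹ᵁ φ.opensRange).ι) '' ((φ₀ ⁻¹ᵁ (B ⁻¹ᵁ ψ.opensRange)).ι ⁻¹' T) =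
      (π ⁻¹ᵁ φ.opensRange).ι '' ((ε.hom : (π ⁻¹ᵁ φ.opensRange : Scheme.{0}) → (B ⁻¹ᵁ ψ.opensRange : Scheme.{0})) ⁻¹'
        (((B ⁻¹ᵁ ψ.opensRange).ι : (B ⁻¹ᵁ ψ.opensRange : Scheme.{0}) → Bl) ⁻¹' (φ₀ '' T))) := by
  -- (i) inside `B⁻¹ ψ(Y)` the piece is `ι⁻¹ (φ₀ T)`
  have h1 : (φ₀ ∣_ (B ⁻¹ᵁ ψ.opensRange)) '' ((φ₀ ⁻¹ᵁ (B ⁻¹ᵁ ψ.opensRange)).ι ⁻¹' T) =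
      ((B ⁻¹ᵁ ψ.opensRange).ι : (B ⁻¹ᵁ ψ.opensRange : Scheme.{0}) → Bl) ⁻¹' (φ₀ '' T) := by
    ext z
    constructor
    · rintro ⟨y, hy, rfl⟩
      refine ⟨(φ₀ ⁻¹ᵁ (B ⁻¹ᵁ ψ.opensRange)).ι y, hy, ?_⟩
      rw [Scheme.Opens.ι_apply]
      change φ₀ y.1 = ((φ₀ ∣_ (B ⁻¹ᵁ ψ.opensRange)) y).1
      rw [morphismRestrict_base_coe]
    · rintro ⟨y, hyT, hyz⟩
      have hyO : y ∈ φ₀ ⁻¹ᵁ (B ⁻¹ᵁ ψ.opensRange) := by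
        change φ₀ y ∈ B ⁻¹ᵁ ψ.opensRange
        rw [hyz]
        exact z.2
      refine ⟨⟨y, hyO⟩, hyT, ?_⟩
      apply Subtype.ext
      rw [morphismRestrict_base_coe]
      exact hyz
  -- (ii) `ε⁻¹` of it is the `ε`-preimage
  have h3 : ε.inv '' ((φ₀ ∣_ (B ⁻¹ᵁ ψ.opensRange)) '' ((φ₀ ⁻¹ᵁ (B ⁻¹ᵁ ψ.opensRange)).ι ⁻¹' T)) =
      (ε.hom : (π ⁻¹ᵁ φ.opensRange : Scheme.{0}) → (B ⁻¹ᵁ ψ.opensRange : Scheme.{0})) ⁻¹'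
        ((φ₀ ∣_ (B ⁻¹ᵁ ψ.opensRange)) '' ((φ₀ ⁻¹ᵁ (B ⁻¹ᵁ ψ.opensRange)).ι ⁻¹' T)) := by
    ext q
    constructor
    · rintro ⟨z, hz, rfl⟩
      show ε.hom (ε.inv z) ∈ (φ₀ ∣_ (B ⁻¹ᵁ ψ.opensRange)) '' ((φ₀ ⁻¹ᵁ (B ⁻¹ᵁ ψ.opensRange)).ι ⁻¹' T)
      rw [← Scheme.Hom.comp_apply, Iso.inv_hom_id]
      exact hz
    · intro hq
      refine ⟨ε.hom q, hq, ?_⟩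
      rw [← Scheme.Hom.comp_apply, Iso.hom_inv_id]
      rfl
  rw [← h1, ← h3, Set.image_image, Set.image_image]
  refine Set.image_congr' fun y => ?_
  simp only [Scheme.Hom.comp_apply]

/-- The pull is monotone. [folklore] -/
theorem zigzag_pull_mono {X X' : Set Bl} (h : X ⊆ X') :
    (π ⁻¹ᵁ φ.opensRange).ι '' ((ε.hom : (π ⁻¹ᵁ φ.opensRange : Scheme.{0}) → (B ⁻¹ᵁ ψ.opensRange : Scheme.{0})) ⁻¹'
        (((B ⁻¹ᵁ ψ.opensRange).ι : (B ⁻¹ᵁ ψ.opensRange : Scheme.{0}) → Bl) ⁻¹' X)) ⊆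
      (π ⁻¹ᵁ φ.opensRange).ι '' ((ε.hom : (π ⁻¹ᵁ φ.opensRange : Scheme.{0}) → (B ⁻¹ᵁ ψ.opensRange : Scheme.{0})) ⁻¹'
        (((B ⁻¹ᵁ ψ.opensRange).ι : (B ⁻¹ᵁ ψ.opensRange : Scheme.{0}) → Bl) ⁻¹' X')) :=
  Set.image_mono (Set.preimage_mono (Set.preimage_mono h))

/-- The pull commutes with binary unions. [folklore] -/
theorem zigzag_pull_union (X X' : Set Bl) :
    (π ⁻¹ᵁ φ.opensRange).ι '' ((ε.hom : (π ⁻¹ᵁ φ.opensRange : Scheme.{0}) → (B ⁻¹ᵁ ψ.opensRange : Scheme.{0})) ⁻¹'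
        (((B ⁻¹ᵁ ψ.opensRange).ι : (B ⁻¹ᵁ ψ.opensRange : Scheme.{0}) → Bl) ⁻¹' (X ∪ X'))) =
      (π ⁻¹ᵁ φ.opensRange).ι '' ((ε.hom : (π ⁻¹ᵁ φ.opensRange : Scheme.{0}) → (B ⁻¹ᵁ ψ.opensRange : Scheme.{0})) ⁻¹'
        (((B ⁻¹ᵁ ψ.opensRange).ι : (B ⁻¹ᵁ ψ.opensRange : Scheme.{0}) → Bl) ⁻¹' X)) ∪
      (π ⁻¹ᵁ φ.opensRange).ι '' ((ε.hom : (π ⁻¹ᵁ φ.opensRange : Scheme.{0}) → (B ⁻¹ᵁ ψ.opensRange : Scheme.{0})) ⁻¹'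
        (((B ⁻¹ᵁ ψ.opensRange).ι : (B ⁻¹ᵁ ψ.opensRange : Scheme.{0}) → Bl) ⁻¹' X')) := by
  rw [Set.preimage_union, Set.preimage_union, Set.image_union]

/-- The pull commutes with indexed unions over a finset of chart indices. [folklore] -/
theorem zigzag_pull_iUnion₂ {ι' : Type*} (s : Finset ι') (X : ι' → Set Bl) :
    (π ⁻¹ᵁ φ.opensRange).ι '' ((ε.hom : (π ⁻¹ᵁ φ.opensRange : Scheme.{0}) → (B ⁻¹ᵁ ψ.opensRange : Scheme.{0})) ⁻¹'
        (((B ⁻¹ᵁ ψ.opensRange).ι : (B ⁻¹ᵁ ψ.opensRange : Scheme.{0}) → Bl) ⁻¹' ⋃ i ∈ s, X i)) =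
      ⋃ i ∈ s, (π ⁻¹ᵁ φ.opensRange).ι '' ((ε.hom : (π ⁻¹ᵁ φ.opensRange : Scheme.{0}) → (B ⁻¹ᵁ ψ.opensRange : Scheme.{0})) ⁻¹'
        (((B ⁻¹ᵁ ψ.opensRange).ι : (B ⁻¹ᵁ ψ.opensRange : Scheme.{0}) → Bl) ⁻¹' X i)) := by
  rw [Set.preimage_iUnion₂, Set.preimage_iUnion₂, Set.image_iUnion₂]

/-- The pull commutes with intersections (the maps are injective). [folklore] -/
theorem zigzag_pull_inter (X X' : Set Bl) :
    (π ⁻¹ᵁ φ.opensRange).ι '' ((ε.hom : (π ⁻¹ᵁ φ.opensRange : Scheme.{0}) → (B ⁻¹ᵁ ψ.opensRange : Scheme.{0})) ⁻¹'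
        (((B ⁻¹ᵁ ψ.opensRange).ι : (B ⁻¹ᵁ ψ.opensRange : Scheme.{0}) → Bl) ⁻¹' (X ∩ X'))) =
      (π ⁻¹ᵁ φ.opensRange).ι '' ((ε.hom : (π ⁻¹ᵁ φ.opensRange : Scheme.{0}) → (B ⁻¹ᵁ ψ.opensRange : Scheme.{0})) ⁻¹'
        (((B ⁻¹ᵁ ψ.opensRange).ι : (B ⁻¹ᵁ ψ.opensRange : Scheme.{0}) → Bl) ⁻¹' X)) ∩
      (π ⁻¹ᵁ φ.opensRange).ι '' ((ε.hom : (π ⁻¹ᵁ φ.opensRange : Scheme.{0}) → (B ⁻¹ᵁ ψ.opensRange : Scheme.{0})) ⁻¹'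
        (((B ⁻¹ᵁ ψ.opensRange).ι : (B ⁻¹ᵁ ψ.opensRange : Scheme.{0}) → Bl) ⁻¹' X')) := by
  rw [Set.preimage_inter, Set.preimage_inter, Set.image_inter (π ⁻¹ᵁ φ.opensRange).ι.isOpenEmbedding.injective]

/-- **The pull preserves disjointness.** [folklore] -/
theorem zigzag_pull_disjoint {X X' : Set Bl} (h : Disjoint X X') :
    Disjoint
      ((π ⁻¹ᵁ φ.opensRange).ι '' ((ε.hom : (π ⁻¹ᵁ φ.opensRange : Scheme.{0}) → (B ⁻¹ᵁ ψ.opensRange : Scheme.{0})) ⁻¹'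
        (((B ⁻¹ᵁ ψ.opensRange).ι : (B ⁻¹ᵁ ψ.opensRange : Scheme.{0}) → Bl) ⁻¹' X)))
      ((π ⁻¹ᵁ φ.opensRange).ι '' ((ε.hom : (π ⁻¹ᵁ φ.opensRange : Scheme.{0}) → (B ⁻¹ᵁ ψ.opensRange : Scheme.{0})) ⁻¹'
        (((B ⁻¹ᵁ ψ.opensRange).ι : (B ⁻¹ᵁ ψ.opensRange : Scheme.{0}) → Bl) ⁻¹' X'))) :=
  (Set.disjoint_image_iff (π ⁻¹ᵁ φ.opensRange).ι.isOpenEmbedding.injective).mpr ((h.preimage _).preimage _)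

/-- The pull lies in `π⁻¹ φ(Y)`. [folklore] -/
theorem zigzag_pull_subset_preimage_opensRange (X : Set Bl) :
    (π ⁻¹ᵁ φ.opensRange).ι '' ((ε.hom : (π ⁻¹ᵁ φ.opensRange : Scheme.{0}) → (B ⁻¹ᵁ ψ.opensRange : Scheme.{0})) ⁻¹'
        (((B ⁻¹ᵁ ψ.opensRange).ι : (B ⁻¹ᵁ ψ.opensRange : Scheme.{0}) → Bl) ⁻¹' X)) ⊆
      ((π ⁻¹ᵁ φ.opensRange : W.Opens) : Set W) := by
  rintro _ ⟨w, -, rfl⟩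
  exact w.2

end ZigzagSets

end Equimultiple

end Summit.ResolutionOfSingularities.ResolutionOfSingularities.Theorems.PIDim4

end
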